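import Summits.QuantumFields.YangMills.Theses.SqueezedSkewness
import Summits.QuantumFields.YangMills.Theorems.LangevinControlUVOSLegsAtWeakCouplingCStubLocalityNear
import HarnessLib

/-!
# Route `SqueezedSkewness`, support `ChordEscalator` (stmt-QuantumFields-23546, LINE χ «chord escalator») — BY NAME

`TorusKL → (femto floor at heights ∈ [h₁, 3h₁]) → (femto ceiling at heights ≥ h_c) → ε^A/C^A ≤ Qrp(v)`, `A = ⌈2δ₁/h₁⌉`, on every
symmetric hypercube `(2L+1)⁴`, every `β ≥ 0` — Lyapunov interpolation on the torus Källén–Lehmann measure, NO infrared input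
(planner ym-idea-6 g12; critic idea-crit-9 VERDICT #56 re-derived the mechanism).  Proof:
* `TorusKL` writes `Qrp(f) = Σ_n W_n ‖amp_s f(μ_n, p_n)‖²` (`W, μ ≥ 0`) for admissible `f`; an UPWARD lattice time shift by `m`
  steps multiplies `amp` by `μ^m` (`amp_shift`: reindex `x ↦ x + m e₀` in the `ℤ⁴` sum; the test function vanishes at non-positive
  lattice times);
* with `N = ⌊h₁/s⌋`, `A' = ⌊(δ₁ − h_c)/(N s)⌋ ≥ 2` and the translates `T_k = v(· + s k e₀)`, the numbers `u_j = Qrp(T_{(A'−j)N})`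
  (`u_0` = the lowest translate, edge `≥ h_c`; `u_1` = edge in `[h₁, 3h₁]`; `u_{A'} = Qrp(v)`) form a positive mixture of geometric
  sequences `Σ_n W_n μ_n^{2jN} ‖Z_n‖²`, hence (Cauchy–Schwarz `tsum_mul_sq_le` + the discrete chord lemma
  `pow_le_pow_mul_of_logConvex`) `u_1^{A'} ≤ u_0^{A'−1} u_{A'}` (`chord_of_mixture`);
* floor `ε ≤ u_1`, ceiling `u_0 ≤ C`, `ε ≤ 1 ≤ C`, `A' ≤ A` give `ε^A/C^A ≤ ε^{A'}/C^{A'−1} ≤ Qrp(v)`.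
(Admissibility of the translates: heights in `(0, δ₂]`, `2δ₂ + 3s ≤ s(2L+1)` from `ρ + δ₂ + 1 ≤ sL`; spatial support inside the open
fundamental cube from `closedBall(e₀, ρ)`; the empty-support case contradicts the floor.)

Fleet lead `ym-spine-19353-p1` g19.  HONEST FRAMING: exact finite-lattice analysis GIVEN `TorusKL` (open, L−) — a conditional
support item; no crux, NT statement, rung of record or mass gap follows. [folklore]
-/

set_option autoImplicit false

noncomputable section

open MeasureTheory Filter Topology
open Literature.MathematicalPhysics.QuantumFieldTheory Literature.MathematicalPhysics.QuantumLattice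

namespace Summit.QuantumFields.YangMills.Theorems.ChordEscalatorProof

/-! ## §1 Discrete log-convexity: the chord above an interior point -/

/-- **Chord escalator, discrete form.**  A non-negative sequence with `u₁ > 0` and the midpoint log-convexity
`u_j² ≤ u_{j−1} u_{j+1}` (`1 ≤ j`, `j + 1 ≤ A`) satisfies `u₁^A ≤ u₀^{A−1} · u_A` (`A ≥ 1`). [folklore] -/
theorem pow_le_pow_mul_of_logConvex (u : ℕ → ℝ) (A : ℕ) (hA : 1 ≤ A) (h0 : ∀ j, j ≤ A → 0 ≤ u j) (h1 : 0 < u 1)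
    (hcs : ∀ j, 1 ≤ j → j + 1 ≤ A → u j ^ 2 ≤ u (j - 1) * u (j + 1)) :
    u 1 ^ A ≤ u 0 ^ (A - 1) * u A := by
  -- `P n : 0 < u n ∧ u (n-1) * u 1 ≤ u 0 * u n ∧ u 1 ^ n ≤ u 0 ^ (n - 1) * u n` for `1 ≤ n ≤ A`
  suffices P : ∀ n, 1 ≤ n → n ≤ A → (0 < u n ∧ u (n - 1) * u 1 ≤ u 0 * u n ∧ u 1 ^ n ≤ u 0 ^ (n - 1) * u n) from
    (P A hA le_rfl).2.2
  intro n hn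
  induction n, hn using Nat.le_induction with
  | base => intro _; exact ⟨h1, by simp, by simp⟩
  | succ n hn ih =>
    intro hnA
    obtain ⟨hpos, hrat, hpow⟩ := ih (by omega)
    have hc := hcs n hn hnA
    have hu0 : 0 ≤ u 0 := h0 0 (Nat.zero_le _)
    have hun1 : 0 ≤ u (n + 1) := h0 (n + 1) hnA
    -- ratio step: `u n * u 1 ≤ u 0 * u (n+1)`
    have hrat' : u n * u 1 ≤ u 0 * u (n + 1) := by
      have h2 : u n ^ 2 * u 1 ≤ u (n - 1) * u (n + 1) * u 1 := mul_le_mul_of_nonneg_right hc h1.le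
      have h3 : u (n - 1) * u (n + 1) * u 1 ≤ u 0 * u n * u (n + 1) := by nlinarith
      nlinarith
    refine ⟨?_, by simpa using hrat', ?_⟩
    · by_contra hneg
      have : u (n + 1) = 0 := le_antisymm (not_lt.1 hneg) hun1
      rw [this, mul_zero] at hrat'
      nlinarith [mul_pos hpos h1]
    · have e : n + 1 - 1 = (n - 1) + 1 := by omega
      rw [pow_succ, e, pow_succ]
      calc u 1 ^ n * u 1 ≤ u 0 ^ (n - 1) * u n * u 1 := mul_le_mul_of_nonneg_right hpow h1.le
        _ = u 0 ^ (n - 1) * (u n * u 1) := by ring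
        _ ≤ u 0 ^ (n - 1) * (u 0 * u (n + 1)) := mul_le_mul_of_nonneg_left hrat' (pow_nonneg hu0 _)
        _ = u 0 ^ (n - 1) * u 0 * u (n + 1) := by ring

/-! ## §2 Cauchy–Schwarz for non-negative series -/

/-- `(Σ' x y)² ≤ (Σ' x²)(Σ' y²)` for non-negative summable-square sequences. [folklore] -/
theorem tsum_mul_sq_le {x y : ℕ → ℝ} (hx : ∀ n, 0 ≤ x n) (hy : ∀ n, 0 ≤ y n)
    (hx2 : Summable fun n => x n ^ 2) (hy2 : Summable fun n => y n ^ 2) :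
    (∑' n, x n * y n) ^ 2 ≤ (∑' n, x n ^ 2) * (∑' n, y n ^ 2) := by
  have hx2' : Summable fun n => x n ^ (2 : ℝ) := by simpa [Real.rpow_two] using hx2
  have hy2' : Summable fun n => y n ^ (2 : ℝ) := by simpa [Real.rpow_two] using hy2
  have h := Real.inner_le_Lp_mul_Lq_tsum_of_nonneg Real.HolderConjugate.two_two hx hy hx2' hy2'
  simp only [Real.rpow_two] at h
  have hX : 0 ≤ ∑' n, x n ^ 2 := tsum_nonneg fun n => sq_nonneg _
  have hY : 0 ≤ ∑' n, y n ^ 2 := tsum_nonneg fun n => sq_nonneg _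
  have hS : 0 ≤ ∑' n, x n * y n := tsum_nonneg fun n => mul_nonneg (hx n) (hy n)
  have h2 : (∑' n, x n * y n) ^ 2 ≤ ((∑' n, x n ^ 2) ^ (1 / 2 : ℝ) * (∑' n, y n ^ 2) ^ (1 / 2 : ℝ)) ^ 2 :=
    pow_le_pow_left₀ hS h 2
  refine h2.trans (le_of_eq ?_)
  rw [mul_pow, ← Real.rpow_natCast ((∑' n, x n ^ 2) ^ (1 / 2 : ℝ)) 2, ← Real.rpow_natCast ((∑' n, y n ^ 2) ^ (1 / 2 : ℝ)) 2,
    ← Real.rpow_mul hX, ← Real.rpow_mul hY]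
  norm_num

/-! ## §3 The chord for a positive mixture of exponentials -/

/-- **Log-convexity of a positive mixture of geometric sequences.**  If `u_j = Σ_n W_n ‖μ_n^{jN} Z_n‖²` (`W, μ ≥ 0`) for
`j ≤ A'` and `u₁ > 0`, then `u₁^{A'} ≤ u₀^{A'−1} u_{A'}` (Cauchy–Schwarz gives the midpoint inequalities, then the discrete
chord lemma). [folklore] -/
theorem chord_of_mixture (W μ : ℕ → ℝ) (hW : ∀ n, 0 ≤ W n) (hμ : ∀ n, 0 ≤ μ n) (N A' : ℕ) (hA' : 1 ≤ A') (Z : ℕ → ℂ)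
    (u : ℕ → ℝ) (hu : ∀ j, j ≤ A' → HasSum (fun n => W n * ‖(((μ n) ^ (j * N) : ℝ) : ℂ) * Z n‖ ^ 2) (u j))
    (h1 : 0 < u 1) : u 1 ^ A' ≤ u 0 ^ (A' - 1) * u A' := by
  -- the summands as `a_n t_n^{2j}`
  set a : ℕ → ℝ := fun n => W n * ‖Z n‖ ^ 2 with ha
  set t : ℕ → ℝ := fun n => μ n ^ N with ht
  have ha0 : ∀ n, 0 ≤ a n := fun n => mul_nonneg (hW n) (sq_nonneg _)
  have ht0 : ∀ n, 0 ≤ t n := fun n => by rw [ht]; exact pow_nonneg (hμ n) _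
  have hterm : ∀ j n, W n * ‖(((μ n) ^ (j * N) : ℝ) : ℂ) * Z n‖ ^ 2 = a n * t n ^ (2 * j) := by
    intro j n
    rw [norm_mul, Complex.norm_real, Real.norm_of_nonneg (pow_nonneg (hμ n) _), ha, ht]
    dsimp only
    rw [← pow_mul, mul_pow, ← pow_mul, show j * N * 2 = N * (2 * j) by ring]
    ring
  have hu' : ∀ j, j ≤ A' → HasSum (fun n => a n * t n ^ (2 * j)) (u j) := fun j hj => by
    have h := hu j hj; simp only [hterm] at h; exact h
  have hu0 : ∀ j, j ≤ A' → 0 ≤ u j := fun j hj =>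
    (hu' j hj).nonneg fun n => mul_nonneg (ha0 n) (pow_nonneg (ht0 n) _)
  -- midpoint log-convexity by Cauchy–Schwarz
  have hcs : ∀ j, 1 ≤ j → j + 1 ≤ A' → u j ^ 2 ≤ u (j - 1) * u (j + 1) := by
    intro j hj hjA
    have ex : ∀ n, Real.sqrt (a n) * t n ^ (j - 1) * (Real.sqrt (a n) * t n ^ (j + 1)) = a n * t n ^ (2 * j) := by
      intro n
      have h2 : t n ^ (j - 1) * t n ^ (j + 1) = t n ^ (2 * j) := by
        rw [← pow_add]; congr 1; omega
      calc Real.sqrt (a n) * t n ^ (j - 1) * (Real.sqrt (a n) * t n ^ (j + 1))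
          = (Real.sqrt (a n) * Real.sqrt (a n)) * (t n ^ (j - 1) * t n ^ (j + 1)) := by ring
        _ = a n * t n ^ (2 * j) := by rw [Real.mul_self_sqrt (ha0 n), h2]
    have ex1 : ∀ n, (Real.sqrt (a n) * t n ^ (j - 1)) ^ 2 = a n * t n ^ (2 * (j - 1)) := by
      intro n; rw [mul_pow, Real.sq_sqrt (ha0 n), ← pow_mul]; congr 1; ring_nf
    have ex2 : ∀ n, (Real.sqrt (a n) * t n ^ (j + 1)) ^ 2 = a n * t n ^ (2 * (j + 1)) := by
      intro n; rw [mul_pow, Real.sq_sqrt (ha0 n), ← pow_mul]; congr 1; ring_nf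
    have hS1 : Summable fun n => (Real.sqrt (a n) * t n ^ (j - 1)) ^ 2 := by
      simp only [ex1]; exact (hu' (j - 1) (by omega)).summable
    have hS2 : Summable fun n => (Real.sqrt (a n) * t n ^ (j + 1)) ^ 2 := by
      simp only [ex2]; exact (hu' (j + 1) hjA).summable
    have h := tsum_mul_sq_le (fun n => mul_nonneg (Real.sqrt_nonneg _) (pow_nonneg (ht0 n) _))
      (fun n => mul_nonneg (Real.sqrt_nonneg _) (pow_nonneg (ht0 n) _)) hS1 hS2
    simp only [ex, ex1, ex2] at h
    rwa [(hu' j (by omega)).tsum_eq, (hu' (j - 1) (by omega)).tsum_eq, (hu' (j + 1) hjA).tsum_eq] at h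
  exact pow_le_pow_mul_of_logConvex u A' hA' hu0 h1 hcs


/-! ## §4 The lattice Laplace amplitude under an upward time shift; supports of translates -/

/-- Base points under a time shift: `s·(x + m e₀) = s·x + (s m)·e₀` in `ℝ⁴`. [folklore] -/
theorem smul_siteToE_add_single (s : ℝ) (m : ℤ) (x : Fin 4 → ℤ) :
    s • siteToE (d := 4) (x + Pi.single 0 m) = s • siteToE (d := 4) x + (s * (m : ℝ)) • EuclideanSpace.single (0 : Fin 4) (1 : ℝ) := by
  ext i
  by_cases hi : i = 0
  · subst hi
    simp [siteToE_apply]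
    ring
  · simp [siteToE_apply, hi]

/-- **Upward time shift multiplies the amplitude by `μ^m`.**  If `f(y) = g(y − s m e₀)` and `g` vanishes at the lattice points
of non-positive time, then `amp_s f (μ, p) = μ^m · amp_s g (μ, p)` for the lattice Laplace–Fourier amplitude of `TorusKL`.
[folklore] -/
theorem amp_shift (s μ : ℝ) (p : Fin 3 → ℝ) (f g : EuclideanSpace ℝ (Fin 4) → ℝ) (m : ℕ)
    (hfg : ∀ y, f y = g (y - (s * (m : ℝ)) • EuclideanSpace.single (0 : Fin 4) (1 : ℝ)))
    (hg0 : ∀ x : Fin 4 → ℤ, x 0 ≤ 0 → g (s • siteToE (d := 4) x) = 0) :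
    (∑' x : Fin 4 → ℤ, (((f (s • siteToE (d := 4) x) * μ ^ Int.toNat (x 0 - 1)) : ℝ) : ℂ) *
        Complex.exp (Complex.I * ((s * ∑ k : Fin 3, p k * (x k.succ : ℝ) : ℝ) : ℂ))) =
      ((μ ^ m : ℝ) : ℂ) * ∑' x : Fin 4 → ℤ, (((g (s • siteToE (d := 4) x) * μ ^ Int.toNat (x 0 - 1)) : ℝ) : ℂ) *
        Complex.exp (Complex.I * ((s * ∑ k : Fin 3, p k * (x k.succ : ℝ) : ℝ) : ℂ)) := by
  rw [← tsum_mul_left]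
  conv_lhs => rw [← (Equiv.addRight (Pi.single (0 : Fin 4) (m : ℤ))).tsum_eq]
  refine tsum_congr fun x => ?_
  simp only [Equiv.coe_addRight]
  have h1 : f (s • siteToE (d := 4) (x + Pi.single 0 (m : ℤ))) = g (s • siteToE (d := 4) x) := by
    rw [hfg, smul_siteToE_add_single, Int.cast_natCast, add_sub_cancel_right]
  have h2 : ∀ k : Fin 3, (((x + Pi.single 0 (m : ℤ) : Fin 4 → ℤ) k.succ : ℤ) : ℝ) = (x k.succ : ℝ) := by
    intro k; simp [Fin.succ_ne_zero]
  have h3 : (x + Pi.single 0 (m : ℤ) : Fin 4 → ℤ) 0 = x 0 + m := by simp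
  simp only [h1, h2, h3]
  by_cases hx : x 0 ≤ 0
  · rw [hg0 x hx]; simp
  · have e : (x 0 + (m : ℤ) - 1).toNat = (x 0 - 1).toNat + m := by omega
    rw [e, pow_add]
    push_cast
    ring

/-- Supports of translates: if `f = v(· + c)` then `y ∈ tsupport f ⇒ y + c ∈ tsupport v`. [folklore] -/
theorem mem_tsupport_of_translate {v f : EuclideanSpace ℝ (Fin 4) → ℝ} {c : EuclideanSpace ℝ (Fin 4)}
    (hf : ∀ y, f y = v (y + c)) {y : EuclideanSpace ℝ (Fin 4)} (hy : y ∈ tsupport f) : y + c ∈ tsupport v := by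
  have hfeq : f = v ∘ fun y => y + c := funext fun y => by simp [hf]
  rw [hfeq] at hy
  have hsub : tsupport (v ∘ fun y : EuclideanSpace ℝ (Fin 4) => y + c) ⊆ (fun y => y + c) ⁻¹' tsupport v :=
    closure_minimal (fun z hz => subset_closure (by simpa [Function.mem_support] using hz))
      ((isClosed_tsupport v).preimage (continuous_id.add continuous_const))
  exact hsub hy

/-! ## §5 `ChordEscalator` -/

set_option maxHeartbeats 800000 in
/-- **`ChordEscalator`** (item stmt-QuantumFields-23546, LINE χ), BY NAME.  From `TorusKL`: on the hypercube `(2L+1)⁴` the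
reflection form of every admissible test function is a positive mixture `Σ_n W_n ‖amp(μ_n, p_n)‖²`, and an UPWARD lattice
time shift by `m` steps multiplies `amp` by `μ^m` (`amp_shift`).  With `N = ⌊h₁/s⌋`, `A' = ⌊(δ₁ − h_c)/(N s)⌋` and the
translates `T_k = v(· + s k e₀)`, the sequence `u_j = Qrp(T_{(A'−j)N})` (`j = 0,…,A'`; `u_0 = Qrp(g)`, `u_1 = Qrp(f₁)`,
`u_{A'} = Qrp(v)`) is a positive mixture of geometric sequences, hence `u_1^{A'} ≤ u_0^{A'−1} u_{A'}` (`chord_of_mixture`); the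
femto floor `ε ≤ u_1` and ceiling `u_0 ≤ C` give `ε^A/C^A ≤ ε^{A'}/C^{A'−1} ≤ Qrp(v)`, `A = ⌈2δ₁/h₁⌉ ≥ A'`. [folklore] -/
theorem chordEscalator_proof : Summit.QuantumFields.YangMills.Theses.SqueezedSkewness.ChordEscalator := by
  intro hKL G _ _ _ _ hG r
  letI : MeasurableSpace G := borel G
  haveI : BorelSpace G := ⟨rfl⟩
  have hK := hKL G r
  dsimp only at hK ⊢
  intro β L s v ρ δ₁ δ₂ h₁ hc ε C hβ hL1 hs hshc hhch hδ hs1 hwin hball hslab hε hε1 hC1 hfloor hceil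
  obtain ⟨W, μ, q, hW, hμ, hsum⟩ := hK β L (2 * L + 1) s hβ hL1 (by omega) hs
  clear hK
  -- the translates `T k = v(· + s k e₀)`
  set E0 : EuclideanSpace ℝ (Fin 4) := EuclideanSpace.single (0 : Fin 4) (1 : ℝ) with hE0
  obtain ⟨T, hT⟩ : ∃ T : ℕ → SchwartzMap (EuclideanSpace ℝ (Fin 4)) ℝ,
      ∀ (k : ℕ) (y : EuclideanSpace ℝ (Fin 4)), T k y = v (y + (s * (k : ℝ)) • E0) :=
    ⟨fun k => SchwartzMap.compSubConstCLM ℝ (-((s * (k : ℝ)) • E0)) v, fun k y => by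
      simp [SchwartzMap.compSubConstCLM_apply, sub_neg_eq_add]⟩
  -- the arithmetic of the equally spaced triple
  have hh1 : 0 < h₁ := by linarith
  have hhc0 : 0 < hc := by linarith
  obtain ⟨N, hN⟩ : ∃ N : ℕ, N = ⌊h₁ / s⌋₊ := ⟨_, rfl⟩
  have hNle : (N : ℝ) ≤ h₁ / s := by rw [hN]; exact Nat.floor_le (by positivity)
  have hNlt : h₁ / s < N + 1 := by rw [hN]; exact Nat.lt_floor_add_one _
  have hNs : (N : ℝ) * s ≤ h₁ := by rwa [le_div_iff₀ hs] at hNle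
  have hNs' : h₁ - s < (N : ℝ) * s := by
    have := hNlt; rw [div_lt_iff₀ hs] at this; linarith
  have hN1 : 1 ≤ N := by
    rw [hN]; exact Nat.floor_pos.2 (by rw [le_div_iff₀ hs]; linarith)
  have h1N : (1 : ℝ) ≤ N := by exact_mod_cast hN1
  have hNs0 : 0 < (N : ℝ) * s := by positivity
  have hNs2 : h₁ < 2 * ((N : ℝ) * s) := by
    have : s ≤ (N : ℝ) * s := by nlinarith
    linarith
  obtain ⟨A', hA'⟩ : ∃ A' : ℕ, A' = ⌊(δ₁ - hc) / (N * s)⌋₊ := ⟨_, rfl⟩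
  have hA'le : (A' : ℝ) ≤ (δ₁ - hc) / (N * s) := by rw [hA']; exact Nat.floor_le (div_nonneg (by linarith) hNs0.le)
  have hA'lt : (δ₁ - hc) / (N * s) < A' + 1 := by rw [hA']; exact Nat.lt_floor_add_one _
  have hA'1 : (A' : ℝ) * (N * s) ≤ δ₁ - hc := by rwa [le_div_iff₀ hNs0] at hA'le
  have hA'2 : δ₁ - hc < ((A' : ℝ) + 1) * (N * s) := by rwa [div_lt_iff₀ hNs0] at hA'lt
  have hA'ge : 2 ≤ A' := by
    have h2 : (2 : ℝ) ≤ (δ₁ - hc) / (N * s) := by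
      rw [le_div_iff₀ hNs0]; nlinarith
    have : (2 : ℝ) < (A' : ℝ) + 1 := lt_of_le_of_lt h2 hA'lt
    have : (1 : ℝ) < A' := by linarith
    exact_mod_cast (show (1 : ℕ) < A' by exact_mod_cast this)
  -- the `k`'s: `k_j = (A' − j) N`
  have hedge : ∀ j : ℕ, j ≤ A' → hc ≤ δ₁ - s * (((A' - j) * N : ℕ) : ℝ) := by
    intro j hj
    push_cast [Nat.cast_sub hj]
    nlinarith [hNs0]
  have hk1a : h₁ ≤ δ₁ - s * (((A' - 1) * N : ℕ) : ℝ) := by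
    rw [Nat.cast_mul, Nat.cast_sub (by omega : 1 ≤ A')]; push_cast; nlinarith
  have hk1b : δ₁ - s * (((A' - 1) * N : ℕ) : ℝ) ≤ 3 * h₁ := by
    rw [Nat.cast_mul, Nat.cast_sub (by omega : 1 ≤ A')]; push_cast; nlinarith
  -- the degenerate case of an empty support: the floor hypothesis is then contradictory
  by_cases hne : (tsupport (v : EuclideanSpace ℝ (Fin 4) → ℝ)).Nonempty
  swap
  · have hv0 : ∀ y, v y = 0 := fun y => by
      by_contra h; exact hne ⟨y, subset_tsupport _ (Function.mem_support.2 h)⟩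
    have hT0 : ∀ y, T ((A' - 1) * N) y = 0 := fun y => by rw [hT, hv0]
    have h := hfloor ((A' - 1) * N) (T ((A' - 1) * N)) hk1a hk1b (hT _)
    simp only [hT0, zero_mul, Finset.sum_const_zero, mul_zero, zero_mul, integral_zero, zero_div, sub_zero] at h
    linarith
  obtain ⟨y₀, hy₀⟩ := hne
  have hρ0 : 0 ≤ ρ := le_trans dist_nonneg (Metric.mem_closedBall.1 (hball hy₀))
  have hδ₂ : 0 < δ₂ := by
    have := hslab hy₀; simp only [Set.mem_setOf_eq] at this; linarith [this.1, this.2]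
  -- admissibility of `v` and of its translates with lower edge `≥ h_c`
  have hH : 2 * δ₂ + 3 * s ≤ s * ((2 * L + 1 : ℕ) : ℝ) := by push_cast; nlinarith
  have hE0t : ∀ (y : EuclideanSpace ℝ (Fin 4)) (t : ℝ), (y + t • E0) 0 = y 0 + t := by
    intro y t; simp [hE0]
  have hE0s : ∀ (y : EuclideanSpace ℝ (Fin 4)) (t : ℝ) (i : Fin 3), (y + t • E0 - E0) i.succ = y i.succ := by
    intro y t i; simp [hE0, Fin.succ_ne_zero]
  have hsp : ∀ (y : EuclideanSpace ℝ (Fin 4)) (t : ℝ), y + t • E0 ∈ tsupport (v : EuclideanSpace ℝ (Fin 4) → ℝ) →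
      ∀ i : Fin 3, |y i.succ| < s * (L + 1 / 2) := by
    intro y t hy i
    have h1 : ‖y + t • E0 - E0‖ ≤ ρ := by
      have := hball hy; rwa [Metric.mem_closedBall, dist_eq_norm] at this
    have h2 := Summit.QuantumFields.YangMills.Theorems.OSLegsAtWeakCouplingC.Loc.abs_apply_le_norm' (y + t • E0 - E0) i.succ
    rw [hE0s] at h2
    nlinarith
  have hv_time : tsupport (v : EuclideanSpace ℝ (Fin 4) → ℝ) ⊆ {y | 0 < y 0 ∧ y 0 ≤ δ₂} := by
    intro y hy
    have := hslab hy; simp only [Set.mem_setOf_eq] at this ⊢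
    constructor <;> linarith [this.1, this.2]
  have hv_space : tsupport (v : EuclideanSpace ℝ (Fin 4) → ℝ) ⊆ {y | ∀ i : Fin 3, |y i.succ| < s * (L + 1 / 2)} := by
    intro y hy i
    have := hsp y 0 (by simpa using hy) i
    exact this
  have hT_time : ∀ k : ℕ, hc ≤ δ₁ - s * k →
      tsupport (T k : EuclideanSpace ℝ (Fin 4) → ℝ) ⊆ {y | 0 < y 0 ∧ y 0 ≤ δ₂} := by
    intro k hk y hy
    have h := hslab (mem_tsupport_of_translate (hT k) hy)
    simp only [Set.mem_setOf_eq, hE0t] at h ⊢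
    have : (0 : ℝ) ≤ s * k := by positivity
    constructor <;> linarith [h.1, h.2]
  have hT_space : ∀ k : ℕ, tsupport (T k : EuclideanSpace ℝ (Fin 4) → ℝ) ⊆ {y | ∀ i : Fin 3, |y i.succ| < s * (L + 1 / 2)} :=
    fun k y hy i => hsp y _ (mem_tsupport_of_translate (hT k) hy) i
  -- the Källén–Lehmann sums
  have hKv := hsum δ₂ v hH hv_time hv_space
  have hKT : ∀ j : ℕ, j ≤ A' → _ := fun j hj =>
    hsum δ₂ (T ((A' - j) * N)) hH (hT_time _ (hedge j hj)) (hT_space _)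
  -- the reference translate `g = T ((A' − 0) N)` and its amplitudes
  obtain ⟨Z, hZ⟩ : ∃ Z : ℕ → ℂ, ∀ n, Z n = ∑' x : Fin 4 → ℤ,
      ((((T ((A' - 0) * N)) (s • siteToE (d := 4) x) * μ n ^ Int.toNat (x 0 - 1)) : ℝ) : ℂ) *
        Complex.exp (Complex.I * ((s * ∑ k : Fin 3, (2 * Real.pi * (q n k : ℝ) / (s * (2 * L + 1))) * (x k.succ : ℝ) : ℝ) : ℂ)) :=
    ⟨_, fun n => rfl⟩
  have hg0 : ∀ x : Fin 4 → ℤ, x 0 ≤ 0 → (T ((A' - 0) * N)) (s • siteToE (d := 4) x) = 0 := by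
    intro x hx
    by_contra h
    have hy := hT_time _ (hedge 0 (Nat.zero_le _)) (subset_tsupport _ (Function.mem_support.2 h))
    simp only [Set.mem_setOf_eq, PiLp.smul_apply, siteToE_apply, smul_eq_mul] at hy
    have : (x 0 : ℝ) ≤ 0 := by exact_mod_cast hx
    nlinarith [hy.1]
  have hfg : ∀ j : ℕ, j ≤ A' → ∀ y : EuclideanSpace ℝ (Fin 4),
      (T ((A' - j) * N)) y = (T ((A' - 0) * N)) (y - (s * (((j * N : ℕ)) : ℝ)) • E0) := by
    intro j hj y
    rw [hT, hT]
    congr 1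
    have e1 : (((A' - j) * N : ℕ) : ℝ) = (A' : ℝ) * N - (j : ℝ) * N := by rw [Nat.cast_mul, Nat.cast_sub hj]; ring
    have e2 : (((A' - 0) * N : ℕ) : ℝ) = (A' : ℝ) * N := by rw [Nat.sub_zero]; push_cast; ring
    have e3 : ((j * N : ℕ) : ℝ) = (j : ℝ) * N := by push_cast; ring
    rw [e1, e2, e3, mul_sub, sub_smul]
    abel
  have hshift : ∀ j : ℕ, j ≤ A' → ∀ n : ℕ,
      (∑' x : Fin 4 → ℤ, ((((T ((A' - j) * N)) (s • siteToE (d := 4) x) * μ n ^ Int.toNat (x 0 - 1)) : ℝ) : ℂ) *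
        Complex.exp (Complex.I * ((s * ∑ k : Fin 3, (2 * Real.pi * (q n k : ℝ) / (s * (2 * L + 1))) * (x k.succ : ℝ) : ℝ) : ℂ)))
        = (((μ n) ^ (j * N) : ℝ) : ℂ) * Z n := by
    intro j hj n
    rw [hZ n]
    exact amp_shift s (μ n) _ _ _ (j * N) (hfg j hj) hg0
  have hfg_v : ∀ y : EuclideanSpace ℝ (Fin 4), v y = (T ((A' - 0) * N)) (y - (s * (((A' * N : ℕ)) : ℝ)) • E0) := by
    intro y; rw [hT, Nat.sub_zero, sub_add_cancel]
  have hshift_v : ∀ n : ℕ,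
      (∑' x : Fin 4 → ℤ, (((v (s • siteToE (d := 4) x) * μ n ^ Int.toNat (x 0 - 1)) : ℝ) : ℂ) *
        Complex.exp (Complex.I * ((s * ∑ k : Fin 3, (2 * Real.pi * (q n k : ℝ) / (s * (2 * L + 1))) * (x k.succ : ℝ) : ℝ) : ℂ)))
        = (((μ n) ^ (A' * N) : ℝ) : ℂ) * Z n := by
    intro n
    rw [hZ n]
    exact amp_shift s (μ n) _ _ _ (A' * N) hfg_v hg0
  -- the mixture
  set u : ℕ → ℝ := fun j => ∑' n, W n * ‖(((μ n) ^ (j * N) : ℝ) : ℂ) * Z n‖ ^ 2 with hu_def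
  have hu : ∀ j, j ≤ A' → HasSum (fun n => W n * ‖(((μ n) ^ (j * N) : ℝ) : ℂ) * Z n‖ ^ 2) (u j) := by
    intro j hj
    exact ((hKT j hj).summable.congr fun n => by beta_reduce; rw [hshift j hj n]).hasSum
  -- the floor, the ceiling and the target in mixture form
  have hfl : ε ≤ u 1 := by
    have h := hfloor ((A' - 1) * N) (T ((A' - 1) * N)) hk1a hk1b (hT _)
    rw [← (hKT 1 (by omega)).tsum_eq] at h
    exact h.trans_eq (tsum_congr fun n => by beta_reduce; rw [hshift 1 (by omega) n])
  have hcl : u 0 ≤ C := by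
    have h := hceil ((A' - 0) * N) (T ((A' - 0) * N)) (hedge 0 (Nat.zero_le _)) (hT _)
    rw [← (hKT 0 (Nat.zero_le _)).tsum_eq] at h
    exact (tsum_congr fun n => by beta_reduce; rw [hshift 0 (Nat.zero_le _) n]).symm.trans_le h
  rw [← hKv.tsum_eq]
  have huA' : (∑' n, W n * ‖(∑' x : Fin 4 → ℤ, (((v (s • siteToE (d := 4) x) * μ n ^ Int.toNat (x 0 - 1)) : ℝ) : ℂ) *
        Complex.exp (Complex.I * ((s * ∑ k : Fin 3, (2 * Real.pi * (q n k : ℝ) / (s * (2 * L + 1))) * (x k.succ : ℝ) : ℝ) : ℂ)))‖ ^ 2)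
      = u A' := tsum_congr fun n => by rw [hshift_v n]
  refine le_of_le_of_eq ?_ huA'.symm
  -- the chord
  have hch := chord_of_mixture W μ hW hμ N A' (by omega) Z u hu (lt_of_lt_of_le hε hfl)
  have hu0 : 0 ≤ u 0 := (hu 0 (Nat.zero_le _)).nonneg fun n => mul_nonneg (hW n) (sq_nonneg _)
  have huA : 0 ≤ u A' := (hu A' le_rfl).nonneg fun n => mul_nonneg (hW n) (sq_nonneg _)
  have hA'A : A' ≤ ⌈2 * δ₁ / h₁⌉₊ := by
    have h1 : (A' : ℝ) ≤ 2 * δ₁ / h₁ := by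
      have h2 : (A' : ℝ) * (N * s) ≤ δ₁ := by linarith
      rw [le_div_iff₀ hh1]
      nlinarith
    exact_mod_cast h1.trans (Nat.le_ceil _)
  have hstep : ε ^ A' ≤ C ^ (A' - 1) * u A' := by
    calc ε ^ A' ≤ u 1 ^ A' := pow_le_pow_left₀ hε.le hfl _
      _ ≤ u 0 ^ (A' - 1) * u A' := hch
      _ ≤ C ^ (A' - 1) * u A' := mul_le_mul_of_nonneg_right (pow_le_pow_left₀ hu0 hcl _) huA
  have hC0 : 0 < C := by linarith
  calc ε ^ ⌈2 * δ₁ / h₁⌉₊ / C ^ ⌈2 * δ₁ / h₁⌉₊ ≤ ε ^ A' / C ^ ⌈2 * δ₁ / h₁⌉₊ :=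
        div_le_div_of_nonneg_right (pow_le_pow_of_le_one hε.le hε1 hA'A) (by positivity)
    _ ≤ ε ^ A' / C ^ (A' - 1) :=
        div_le_div_of_nonneg_left (by positivity) (by positivity) (pow_le_pow_right₀ hC1 (by omega))
    _ ≤ u A' := by rw [div_le_iff₀ (by positivity)]; linarith [hstep]

end Summit.QuantumFields.YangMills.Theorems.ChordEscalatorProof

end
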